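import Summits.RiemannHypothesis.RiemannHypothesis.Theorems.PfPersistenceDefectiveTransportShape
import Mathlib.Analysis.Convex.SpecificFunctions.Basic
import Mathlib.Analysis.Convex.SpecificFunctions.Pow
import HarnessLib

/-!
# PF persistence campaign (cell `pub-rhpf`, leaf G1.22 TRANSPORT-1, gen 8): the transport kernel of
record, part 8c — the clock scale of the SHAPE FACE is ORDERED

Honest framing (verbatim, applies to every line): mechanism/rigidity campaign; no RH claims.

Part 8 (`PfPersistenceDefectiveTransportShape`, d84b8e9e03e3) graded the eventual shape of
`ε = Literature.NumberTheory.LFunctions.weilGroundEnergy` against the exponential clocks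
`t = e^{κ a}`: convexity against the clock of rate `κ` feeds the floor dictionary at rate `κ`
(`floor_of_convexOn_clock`, strip `|Re ρ − 1/2| ≤ κ/2`), convexity in `a` itself gives RH,
concavity against any increasing clock refutes RH.  RULING A267 (A3)(v) of the cell admitted the
ordering of these hypotheses along the clock scale only as a DERIVED remark.  This part makes it
kernel: two abstract composition lemmas (a convex ANTITONE function of a concave argument is convex;
a concave antitone function of a convex argument is concave — Mathlib's `ConvexOn.comp_concaveOn`
pattern, re-proved here on a target half-line so that no image-set bookkeeping is needed) and the
monotonicity of `ε` on `(0, ∞)` (`weilGroundEnergy_anti`, Bombieri) give: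

* `convexOn_clock_of_convexOn` — convex in `a` on `[b, ∞)`, `b > 0` ⟹ convex against EVERY clock
  `e^{κ a}`, `κ > 0`;
* `convexOn_clock_mono` — convex against `e^{κ₁ a}` ⟹ convex against `e^{κ₂ a}` for `κ₂ ≥ κ₁`
  (convexity propagates UP the clock scale);
* `concaveOn_of_concaveOn_clock`, `concaveOn_clock_anti` — concavity propagates DOWN the scale and
  to `a` itself;
* `clockConvexRates` — the SET of rates `κ > 0` against whose clock `ε` is eventually convex — is an
  UPPER set (`mem_clockConvexRates_of_le`), contains every `κ > 0` if `ε` is eventually convex in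
  `a` (`mem_clockConvexRates_of_convexOn`), and each member confines the nontrivial zeros to
  `|Re ρ − 1/2| ≤ κ/2` (`abs_re_sub_half_le_of_mem_clockConvexRates`, part 8).  Its infimum is the
  informal "shape exponent κ⁺" of TRANSPORT.md §17; NO real number is asserted to lie in the set.

Every convexity / concavity clause is a HYPOTHESIS; nothing here is a step toward RH; no reach
number is produced.  References: E. Bombieri, Rend. Mat. Acc. Lincei (9) 11 (2000) §4;
A. Connes, C. Consani, H. Moscovici, arXiv:2511.22755 §3; composition of convex functions
[folklore] (`ConvexOn.comp_concaveOn`).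
-/

noncomputable section

set_option linter.dupNamespace false

namespace Summit.RiemannHypothesis.RiemannHypothesis.Theorems.PfPersistenceDefectiveTransport

open Set
open _root_.Literature.NumberTheory.LFunctions

/-! ## §1 Two abstract composition lemmas on a target half-line -/

/-- A function convex AND antitone on `[b, ∞)`, composed with a concave argument taking values in
`[b, ∞)`, is convex. RH-free. [folklore] -/
theorem convexOn_comp_of_concaveOn {f φ : ℝ → ℝ} {S : Set ℝ} {b : ℝ}
    (hf : ConvexOn ℝ (Ici b) f) (hfa : AntitoneOn f (Ici b))
    (hφ : ConcaveOn ℝ S φ) (hφb : ∀ x ∈ S, b ≤ φ x) :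
    ConvexOn ℝ S (fun x : ℝ => f (φ x)) := by
  refine ⟨hφ.1, ?_⟩
  intro x hx y hy a c ha hc hac
  have h1 : a • φ x + c • φ y ≤ φ (a • x + c • y) := hφ.2 hx hy ha hc hac
  have hxS : b ≤ φ x := hφb x hx
  have hyS : b ≤ φ y := hφb y hy
  have hzS : b ≤ φ (a • x + c • y) := hφb _ (hφ.1 hx hy ha hc hac)
  have hcomb : b ≤ a • φ x + c • φ y := by
    have hb' : a * b + c * b = b := by rw [← add_mul, hac, one_mul]
    simp only [smul_eq_mul]
    nlinarith [mul_nonneg ha (sub_nonneg.2 hxS), mul_nonneg hc (sub_nonneg.2 hyS), hb']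
  calc f (φ (a • x + c • y)) ≤ f (a • φ x + c • φ y) :=
        hfa (mem_Ici.2 hcomb) (mem_Ici.2 hzS) h1
    _ ≤ a • f (φ x) + c • f (φ y) := hf.2 (mem_Ici.2 hxS) (mem_Ici.2 hyS) ha hc hac

/-- A function concave AND antitone on `[b, ∞)`, composed with a convex argument taking values in
`[b, ∞)`, is concave. RH-free. [folklore] -/
theorem concaveOn_comp_of_convexOn {f φ : ℝ → ℝ} {S : Set ℝ} {b : ℝ}
    (hf : ConcaveOn ℝ (Ici b) f) (hfa : AntitoneOn f (Ici b))
    (hφ : ConvexOn ℝ S φ) (hφb : ∀ x ∈ S, b ≤ φ x) :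
    ConcaveOn ℝ S (fun x : ℝ => f (φ x)) := by
  refine ⟨hφ.1, ?_⟩
  intro x hx y hy a c ha hc hac
  have h1 : φ (a • x + c • y) ≤ a • φ x + c • φ y := hφ.2 hx hy ha hc hac
  have hxS : b ≤ φ x := hφb x hx
  have hyS : b ≤ φ y := hφb y hy
  have hzS : b ≤ φ (a • x + c • y) := hφb _ (hφ.1 hx hy ha hc hac)
  have hcomb : b ≤ a • φ x + c • φ y := by
    have hb' : a * b + c * b = b := by rw [← add_mul, hac, one_mul]
    simp only [smul_eq_mul]
    nlinarith [mul_nonneg ha (sub_nonneg.2 hxS), mul_nonneg hc (sub_nonneg.2 hyS), hb']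
  calc a • f (φ x) + c • f (φ y) ≤ f (a • φ x + c • φ y) :=
        hf.2 (mem_Ici.2 hxS) (mem_Ici.2 hyS) ha hc hac
    _ ≤ f (φ (a • x + c • y)) := hfa (mem_Ici.2 hzS) (mem_Ici.2 hcomb) h1

/-! ## §2 The clock functions and their monotonicity -/

/-- `ε` is antitone on `[b, ∞)` for `b > 0` (Bombieri; `weilGroundEnergy_anti`). RH-free. -/
theorem antitoneOn_weilGroundEnergy_Ici {b : ℝ} (hb : 0 < b) :
    AntitoneOn weilGroundEnergy (Ici b) :=
  fun _ hx _ _ hxy => weilGroundEnergy_anti (hb.trans_le hx) hxy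

/-- The clock function `t ↦ ε (log t / κ)` (`κ > 0`) is antitone on `[t₀, ∞)` for `t₀ > 1`
(windows `log t / κ > 0`). RH-free. -/
theorem antitoneOn_clock {κ t₀ : ℝ} (hκ : 0 < κ) (ht₀ : 1 < t₀) :
    AntitoneOn (fun t : ℝ => weilGroundEnergy (Real.log t / κ)) (Ici t₀) := by
  intro x hx y _ hxy
  have hx1 : 1 < x := ht₀.trans_le hx
  have hx0 : 0 < x := one_pos.trans hx1
  have hlx : 0 < Real.log x / κ := div_pos (Real.log_pos hx1) hκ
  exact weilGroundEnergy_anti hlx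
    (div_le_div_of_nonneg_right (Real.log_le_log hx0 hxy) hκ.le)

/-- `t ↦ log t / κ` is concave on any `[t₀, ∞)`, `t₀ > 0`. RH-free. [folklore] -/
theorem concaveOn_log_div {κ t₀ : ℝ} (hκ : 0 < κ) (ht₀ : 0 < t₀) :
    ConcaveOn ℝ (Ici t₀) (fun t : ℝ => Real.log t / κ) := by
  have hS : Ici t₀ ⊆ Ioi (0 : ℝ) := fun t ht => ht₀.trans_le ht
  have hlog : ConcaveOn ℝ (Ici t₀) Real.log :=
    strictConcaveOn_log_Ioi.concaveOn.subset hS (convex_Ici _)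
  refine (hlog.smul (inv_nonneg.2 hκ.le)).congr ?_
  intro t _
  simp only [smul_eq_mul]
  rw [div_eq_inv_mul]

/-- **Convex in `a` ⟹ convex against every exponential clock.**  If `ε` is convex on `[b, ∞)`
(`b > 0`), then for every `κ > 0` the clock function `t ↦ ε (log t / κ)` is convex on
`[e^{κ b}, ∞)`.  RH-free implication; the convexity hypothesis is NOT claimed. [folklore] -/
theorem convexOn_clock_of_convexOn {b κ : ℝ} (hb : 0 < b) (hκ : 0 < κ)
    (hconv : ConvexOn ℝ (Ici b) weilGroundEnergy) :
    ConvexOn ℝ (Ici (Real.exp (κ * b))) (fun t : ℝ => weilGroundEnergy (Real.log t / κ)) := by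
  refine convexOn_comp_of_concaveOn hconv (antitoneOn_weilGroundEnergy_Ici hb)
    (concaveOn_log_div hκ (Real.exp_pos _)) ?_
  intro t ht
  have ht0 : 0 < t := (Real.exp_pos _).trans_le ht
  have h1 : κ * b ≤ Real.log t := by
    have := Real.log_le_log (Real.exp_pos (κ * b)) ht
    rwa [Real.log_exp] at this
  rw [le_div_iff₀ hκ]
  linarith

/-- **Convexity propagates UP the clock scale.**  If `t ↦ ε (log t / κ₁)` is convex on `[t₀, ∞)`
(`t₀ > 1`, `κ₁ > 0`) and `κ₁ ≤ κ₂`, then `s ↦ ε (log s / κ₂)` is convex on `[t₀ ^ (κ₂/κ₁), ∞)`: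
`ε (log s / κ₂) = ε (log (s ^ {κ₁/κ₂}) / κ₁)` and `s ↦ s ^ {κ₁/κ₂}` is concave.  RH-free
implication; no convexity is claimed. [folklore] -/
theorem convexOn_clock_mono {κ₁ κ₂ t₀ : ℝ} (hκ₁ : 0 < κ₁) (h12 : κ₁ ≤ κ₂) (ht₀ : 1 < t₀)
    (hconv : ConvexOn ℝ (Ici t₀) (fun t : ℝ => weilGroundEnergy (Real.log t / κ₁))) :
    ConvexOn ℝ (Ici (t₀ ^ (κ₂ / κ₁))) (fun s : ℝ => weilGroundEnergy (Real.log s / κ₂)) := by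
  have hκ₂ : 0 < κ₂ := hκ₁.trans_le h12
  set p : ℝ := κ₁ / κ₂ with hp
  have hp0 : 0 < p := div_pos hκ₁ hκ₂
  have hp1 : p ≤ 1 := (div_le_one hκ₂).2 h12
  have ht₀0 : 0 < t₀ := one_pos.trans ht₀
  have hs₀ : 0 < t₀ ^ (κ₂ / κ₁) := Real.rpow_pos_of_pos ht₀0 _
  have hS0 : Ici (t₀ ^ (κ₂ / κ₁)) ⊆ Ici (0 : ℝ) := fun s hs => hs₀.le.trans hs
  -- `s ↦ s ^ p` concave on the half-line
  have hφ : ConcaveOn ℝ (Ici (t₀ ^ (κ₂ / κ₁))) (fun s : ℝ => s ^ p) :=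
    (Real.concaveOn_rpow hp0.le hp1).subset hS0 (convex_Ici _)
  -- values land in `[t₀, ∞)`
  have hφb : ∀ s ∈ Ici (t₀ ^ (κ₂ / κ₁)), t₀ ≤ s ^ p := by
    intro s hs
    have h := Real.rpow_le_rpow hs₀.le hs hp0.le
    have e : (t₀ ^ (κ₂ / κ₁)) ^ p = t₀ := by
      rw [hp, ← Real.rpow_mul ht₀0.le]
      have : κ₂ / κ₁ * (κ₁ / κ₂) = 1 := by field_simp
      rw [this, Real.rpow_one]
    rwa [e] at h
  have hcomp := convexOn_comp_of_concaveOn hconv (antitoneOn_clock hκ₁ ht₀) hφ hφb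
  refine hcomp.congr ?_
  intro s hs
  have hs0 : 0 < s := hs₀.trans_le hs
  show weilGroundEnergy (Real.log (s ^ p) / κ₁) = weilGroundEnergy (Real.log s / κ₂)
  rw [Real.log_rpow hs0, hp]
  congr 1
  field_simp

/-- **Concavity against a clock ⟹ concavity in `a`.**  If `t ↦ ε (log t / κ)` is concave on
`[t₀, ∞)` (`t₀ > 1`, `κ > 0`), then `ε` is concave on `[log t₀ / κ, ∞)`: `ε a = g (e^{κ a})` with
`a ↦ e^{κ a}` convex.  RH-free implication; no concavity is claimed. [folklore] -/
theorem concaveOn_of_concaveOn_clock {κ t₀ : ℝ} (hκ : 0 < κ) (ht₀ : 1 < t₀)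
    (hconc : ConcaveOn ℝ (Ici t₀) (fun t : ℝ => weilGroundEnergy (Real.log t / κ))) :
    ConcaveOn ℝ (Ici (Real.log t₀ / κ)) weilGroundEnergy := by
  have ht₀0 : 0 < t₀ := one_pos.trans ht₀
  -- `a ↦ exp (κ a)` convex
  have hφ : ConvexOn ℝ (Ici (Real.log t₀ / κ)) (fun a : ℝ => Real.exp (κ * a)) := by
    have h := (convexOn_exp.comp_linearMap (LinearMap.lsmul ℝ ℝ κ)).subset (subset_univ _)
      (convex_Ici (Real.log t₀ / κ))
    refine h.congr ?_
    intro a _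
    simp [smul_eq_mul]
  have hφb : ∀ a ∈ Ici (Real.log t₀ / κ), t₀ ≤ Real.exp (κ * a) := by
    intro a ha
    have h1 : Real.log t₀ ≤ κ * a := by
      have := mem_Ici.1 ha
      rw [div_le_iff₀ hκ] at this
      linarith
    calc t₀ = Real.exp (Real.log t₀) := (Real.exp_log ht₀0).symm
      _ ≤ Real.exp (κ * a) := Real.exp_le_exp.2 h1
  have hcomp := concaveOn_comp_of_convexOn hconc (antitoneOn_clock hκ ht₀) hφ hφb
  refine hcomp.congr ?_
  intro a _
  show weilGroundEnergy (Real.log (Real.exp (κ * a)) / κ) = weilGroundEnergy a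
  rw [Real.log_exp, mul_div_cancel_left₀ _ hκ.ne']

/-- **Concavity propagates DOWN the clock scale.**  If `s ↦ ε (log s / κ₂)` is concave on
`[s₀, ∞)` (`s₀ > 1`) and `0 < κ₁ ≤ κ₂`, then `t ↦ ε (log t / κ₁)` is concave on `[s₀ ^ (κ₁/κ₂), ∞)`
(`t ↦ t ^ {κ₂/κ₁}` is convex).  RH-free implication; no concavity is claimed. [folklore] -/
theorem concaveOn_clock_anti {κ₁ κ₂ s₀ : ℝ} (hκ₁ : 0 < κ₁) (h12 : κ₁ ≤ κ₂) (hs₀ : 1 < s₀)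
    (hconc : ConcaveOn ℝ (Ici s₀) (fun s : ℝ => weilGroundEnergy (Real.log s / κ₂))) :
    ConcaveOn ℝ (Ici (s₀ ^ (κ₁ / κ₂))) (fun t : ℝ => weilGroundEnergy (Real.log t / κ₁)) := by
  have hκ₂ : 0 < κ₂ := hκ₁.trans_le h12
  set q : ℝ := κ₂ / κ₁ with hq
  have hq1 : 1 ≤ q := (one_le_div hκ₁).2 h12
  have hq0 : 0 < q := one_pos.trans_le hq1
  have hs₀0 : 0 < s₀ := one_pos.trans hs₀
  have ht₀ : 0 < s₀ ^ (κ₁ / κ₂) := Real.rpow_pos_of_pos hs₀0 _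
  have hS0 : Ici (s₀ ^ (κ₁ / κ₂)) ⊆ Ici (0 : ℝ) := fun t ht => ht₀.le.trans ht
  have hφ : ConvexOn ℝ (Ici (s₀ ^ (κ₁ / κ₂))) (fun t : ℝ => t ^ q) :=
    (convexOn_rpow hq1).subset hS0 (convex_Ici _)
  have hφb : ∀ t ∈ Ici (s₀ ^ (κ₁ / κ₂)), s₀ ≤ t ^ q := by
    intro t ht
    have h := Real.rpow_le_rpow ht₀.le ht hq0.le
    have e : (s₀ ^ (κ₁ / κ₂)) ^ q = s₀ := by
      rw [hq, ← Real.rpow_mul hs₀0.le]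
      have : κ₁ / κ₂ * (κ₂ / κ₁) = 1 := by field_simp
      rw [this, Real.rpow_one]
    rwa [e] at h
  have hcomp := concaveOn_comp_of_convexOn hconc (antitoneOn_clock hκ₂ hs₀) hφ hφb
  refine hcomp.congr ?_
  intro t ht
  have ht0 : 0 < t := ht₀.trans_le ht
  show weilGroundEnergy (Real.log (t ^ q) / κ₂) = weilGroundEnergy (Real.log t / κ₁)
  rw [Real.log_rpow ht0, hq]
  congr 1
  field_simp

/-! ## §3 The set of clock-convex rates is an upper set; its members confine the zeros -/

/-- The set of rates `κ > 0` against whose clock `t = e^{κ a}` the Weil bottom is EVENTUALLY CONVEX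
(on some `[t₀, ∞)`, `t₀ > 0`).  A definition only: NO real number is asserted to belong to it; its
infimum is the informal "shape exponent κ⁺" of TRANSPORT.md §17.  no RH claim. -/
def clockConvexRates : Set ℝ :=
  {κ : ℝ | 0 < κ ∧
    ∃ t₀ : ℝ, 0 < t₀ ∧ ConvexOn ℝ (Ici t₀) (fun t : ℝ => weilGroundEnergy (Real.log t / κ))}

/-- **`clockConvexRates` is an UPPER set**: `κ₁ ∈` it and `κ₁ ≤ κ₂` give `κ₂ ∈` it
(`convexOn_clock_mono`, after moving the base past `1`).  RH-free. -/
theorem mem_clockConvexRates_of_le {κ₁ κ₂ : ℝ} (h₁ : κ₁ ∈ clockConvexRates) (h12 : κ₁ ≤ κ₂) :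
    κ₂ ∈ clockConvexRates := by
  obtain ⟨hκ₁, t₀, ht₀, hconv⟩ := h₁
  have ht₁ : 1 < max t₀ 2 := by
    have : (2 : ℝ) ≤ max t₀ 2 := le_max_right _ _
    linarith
  have hconv' : ConvexOn ℝ (Ici (max t₀ 2)) (fun t : ℝ => weilGroundEnergy (Real.log t / κ₁)) :=
    hconv.subset (Ici_subset_Ici.2 (le_max_left _ _)) (convex_Ici _)
  refine ⟨hκ₁.trans_le h12, (max t₀ 2) ^ (κ₂ / κ₁), Real.rpow_pos_of_pos (one_pos.trans ht₁) _, ?_⟩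
  exact convexOn_clock_mono hκ₁ h12 ht₁ hconv'

/-- `clockConvexRates` is upward closed (restatement as `IsUpperSet`). RH-free. -/
theorem isUpperSet_clockConvexRates : IsUpperSet clockConvexRates :=
  fun _ _ h12 h₁ => mem_clockConvexRates_of_le h₁ h12

/-- **Eventual convexity in `a` puts EVERY rate in the set** (`convexOn_clock_of_convexOn`).
RH-free implication; the convexity hypothesis is NOT claimed (it would imply RH, part 8
`riemannHypothesis_of_convexOn`). -/
theorem mem_clockConvexRates_of_convexOn {b : ℝ} (hb : 0 < b)
    (hconv : ConvexOn ℝ (Ici b) weilGroundEnergy) {κ : ℝ} (hκ : 0 < κ) :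
    κ ∈ clockConvexRates :=
  ⟨hκ, Real.exp (κ * b), Real.exp_pos _, convexOn_clock_of_convexOn hb hκ hconv⟩

/-- **Each member of `clockConvexRates` confines the nontrivial zeros to `|Re ρ − 1/2| ≤ κ/2`**
(part 8 `strip_of_convexOn_clock`); content only for `κ < 1`.  RH-free implication; membership is
NOT claimed for any `κ`. -/
theorem abs_re_sub_half_le_of_mem_clockConvexRates {κ : ℝ} (hκ : κ ∈ clockConvexRates)
    {ρ : ℂ} (hρ : ρ ∈ ZetaZeros.riemannZetaNontrivialZeros) : |ρ.re - 1 / 2| ≤ κ / 2 := by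
  obtain ⟨hκ0, t₀, ht₀, hconv⟩ := hκ
  exact strip_of_convexOn_clock hκ0 ht₀ hconv hρ

/-- Each member gives quasi-RH at `1/2 + κ/2` (part 8). RH-free implication; no membership
claimed. -/
theorem quasiRiemannHypothesis_of_mem_clockConvexRates {κ : ℝ} (hκ : κ ∈ clockConvexRates) :
    QuasiRiemannHypothesis (1 / 2 + κ / 2) := by
  obtain ⟨hκ0, t₀, ht₀, hconv⟩ := hκ
  exact quasiRiemannHypothesis_of_convexOn_clock hκ0 ht₀ hconv

/-- **Ω-form**: a nontrivial zero off the line by more than `κ/2` excludes `κ` — and, the set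
being upper, every SMALLER rate — from `clockConvexRates`. RH-free. -/
theorem not_mem_clockConvexRates_of_offline_zero {ρ : ℂ}
    (hρ : ρ ∈ ZetaZeros.riemannZetaNontrivialZeros) {κ : ℝ} (hfar : κ / 2 < |ρ.re - 1 / 2|) :
    κ ∉ clockConvexRates :=
  fun h => (not_le.2 hfar) (abs_re_sub_half_le_of_mem_clockConvexRates h hρ)

/-- **If `ε` is eventually convex in `a`, EVERY rate `κ > 0` is clock-convex: the set is all of
`(0, ∞)`** (so its infimum, the informal κ⁺, would be `0`).  RH-free implication; the convexity
hypothesis is NOT claimed (it implies RH, part 8 `riemannHypothesis_of_convexOn`). -/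
theorem clockConvexRates_eq_Ioi_of_convexOn {b : ℝ} (hb : 0 < b)
    (hconv : ConvexOn ℝ (Ici b) weilGroundEnergy) : clockConvexRates = Ioi 0 := by
  ext κ
  exact ⟨fun h => h.1, fun h => mem_clockConvexRates_of_convexOn hb hconv h⟩

end Summit.RiemannHypothesis.RiemannHypothesis.Theorems.PfPersistenceDefectiveTransport

end
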